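import Summits.QuantumFields.YangMills.Theorems.BalabanUVNodesN18KingModelScales
import Literature.MathematicalPhysics.QuantumFieldTheory.Balaban1983to89.Node00.U3KernelLetters

/-!
# BalabanUVNodes ∕ N18 — KING's (3.73) ∕ (4.42)–(4.43) MECHANISM AT THE KERNEL OBJECTS: three-factor limiting (1.21) kernels with one-line rates on the window `]0, γ]^ℕ`
# ⟹ the N18 LETTER `KernelStepRate` (node00-def-W1 W1-19b) AT KING-MODEL SCALES `θ₅ = L^{−α}`, and the (5.10) class letter `KernelDecay` ∕ node U3's `DecayBound` from the SIZES
# (Track A, DAG node N18 = NE5 `T4OutputRate.NE5`; cluster K4 «SpineRates»; key K3⁷ `SpineGivenEndpointR13SepCoPH` stmt-QuantumFields-20544, skeleton v5 941dddb108cbaacf; width seat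
# `pub-ymgap-dag-n18-w4` g0 — START-LIST §n18 item 3 «NE5 at the KING-MODEL scales with the record's window» in the PINNED (kernel) currency; FILE 1 of 2, the record ∕ pin
# edition is `…N18KernelStepRateKingMechanismRecord`)

HONEST FRAMING.  Count-neutral kernel bookkeeping BY NAME (`--kind proof --supports stmt-QuantumFields-20544 --as helper`).  HYPOTHESIS-FORM MECHANISM LEMMAS: the
three-factor structure `u ⬝ (E v)` of Bałaban's limiting (1.21) kernels `Π_{k+1,μν}(g; z)` of the merged term (1.6), their sizes, one-line rates and lattice sums are
HYPOTHESES — C. King's printed MODEL OF THE MECHANISM ([King1986] p. 665 «If we replace such a propagator in E_φ^{(k+n)}(H̃), the error is the same graph with a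
difference of propagators on one line. Using the method presented, this error is bounded, and Proposition 3.8 gives the desired factor L^{−γk}.», (4.42)–(4.43) p. 675)
read at node00-def-W1's kernel objects; NE5 for Bałaban's outputs is NOT PRINTED for d = 4 ([Balaban1987RG1] Thm 1 p. 259 prints the UNIFORMITY in the spacing only) and
is NOT proved here; the (1.21) kernels are NOT King's covariances.  Nothing of Bałaban is asserted; N18 NOT discharged; (5.10) NOT discharged; K3⁷ OPEN, not claimed; counts
UNMOVED (typed 28∕28 · discharged 5∕27, A 5∕28).  One finite four-torus programme at fixed `ε`, Bałaban AS PRINTED; R4 closes the conditional finite-𝕋⁴ rung `BalabanLadder.UV`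
only — NOT ℝ⁴, NOT infinite volume, NOT OS, NOT a mass gap, NOT Clay.  THEOREMS ONLY: 0 `def`, 0 `sorry`, standard axioms.

WHY (the v5 currency).  Since K3⁷ v3 the reading's node-U3 objects are PINNED BY NAME to `Node00.U3OfKernels.objectsOfRecord₁₃ F N θ ℓ` (`U3PinnedKernels`): ONE
background-free kernel carrier `(k, μ, ν, z)`, run A's functional STORING `Π_{k+1,μν}(g; z) = kernelA g k μ ν z`, run B's the level-`(k+2)` kernel at `(b, g)`.  Under the pin
the N18 conjunct of `KeyedRatesHolderD4` COSTS EXACTLY W1-19b's letter `KernelStepRateOfRecord₁₃ F N θ ℓ.κ ℓ.θ₅ ℓ.C₅` (dag-n18-w1 `…N18AtRecordOfKernelLetters`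
`n18At_rateCarriers_of_kernels_pin_iff_letter`, p597580): `|Π_{k+1}(g; z) − Π_{k+2}(b, g; z)| ≤ C₅ θ₅^{k+1} e^{−κ|z|₁}` on `]0, θ.γ]^ℕ`.  The START-LIST §n18 item-3 rungs of
record (dag-n18-w3 g0 `…N18KingModelRecordWindow` p583713 ∕ `…TorusSigma` p585947, dag-n10-w2 `…N18KingModelVertexRecordWindow`) place King's model in the
`U3Objects₁₁.ofFixed C EA EB ℓ` bundle on King's OWN carriers — a reading the pin no longer admits.  THIS FILE types King's mechanism where the pin reads: at the kernel
objects, producing the LETTER (not a model bundle), with factor data READING the couplings `g` ∕ `(b, g)` (COUPLED — dag-n18-a's `…N18KingModelScales.ne5_of_threeFactorRates`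
p415038 has coupling-BLIND data `uA X, CA X, …`).

WHAT.
* §1 (any `Carriers`, COUPLED and DRESSED factor data `(g, U, X) ↦ u, E, v`): ★ `ne5_of_threeFactorRates_coupled` — p415038's knit `bilin3_rate` with factor data reading
  the couplings and run B's background, bounds asked ON THE WINDOW only ⟹ `NE5 EA EB W (κ∕2) θ ((cA·sC·sB + sA·cC·sB + sA·sC·cB)·V²)`; `decayBound_of_threeFactorSizes_coupled`
  — the undifferenced SIZES (`bilin_decay_bound`) ⟹ node U3's own decay slot `DecayBound EA W (sA·sC·sB·V²) (κ∕2)` ((0.25)∕(1.18) shape, UNIFORM constant).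
* §2 (kernel currency, generic term family `ℰ`, probe `ρ`, basis `bV`, window radius `γ`): ★★ `kernelStepRate_of_threeFactorRates` — if `Π_{k+1}(g; z) = u_A ⬝ (E_A v_A)` and
  `Π_{k+2}(b, g; z) = u_B ⬝ (E_B v_B)` over a level-`k` summation lattice `β k` with positions `q k : β k → P k`, read positions `p, r` with `|z|₁ ≤ ρ_k(p, r)`, sizes
  `sA, sC, sB`, ONE-LINE RATES `cA·θ₅^{k+1}, cC·θ₅^{k+1}, cB·θ₅^{k+1}`, decay `κ` through the positions and lattice sums `≤ V`, all on `]0, γ]^ℕ`, then `KernelStepRate F ℰ ρ bV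
  γ (κ∕2) θ₅ ((cA·sC·sB + sA·cC·sB + sA·sC·cB)·V²)`; `abs_kernelA_le_of_threeFactorSizes` ∕ ★ `decayBound_EA_of_threeFactorSizes` ∕ ★ `kernelDecay_of_threeFactorSizes` — run A's
  SIZES alone ⟹ `|Π_{k+1}(g; z)| ≤ sA·sC·sB·V²·e^{−(κ∕2)|z|₁}`, i.e. W1-19's `DecayBound (EA F ℰ ρ bV) (Window γ) …` (the UNIFORM decay (UD) dag-n18-w1's
  `scaleShiftRate_betaMerged_of_n18At_objects_of_decayBound` reads for N17) and the (5.10) class letter `KernelDecay … μ ν (κ∕2)` (= (D4)'s `hdec`); monotonicity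
  `kernelStepRate_mono` (window ∕ rate ∕ ratio ∕ constant) and `kernelDecay_anti` (rate).
* §3 KING-MODEL SCALES: ★★ `kernelStepRate_of_threeFactorRates_kingScales` — outer one-line rates `cA·(L^{−α})^{k+1}`, `cB·(L^{−α})^{k+1}` (Prop. 3.8 (3.71) p. 664), middle
  `cC·(L^{k+1})⁻¹` (Lemma 4.5 (4.38) p. 674; `L ≥ 1`, `α ≤ 1`: dominated through p415038 `inv_pow_le_kingTheta_pow`) ⟹ the letter with ONE `θ₅ = L^{−α}`;
  `kingScales_letters_signs` — the block `⟨κ, L^{−α}, C₅, C₉, ω, cr, ρ⟩` has `U3Letters₁₁.Signs` for `L ≥ 2`, `α > 0` under the sign rows (α-form of p583713's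
  `kingModel_letters_signs`, which is `α = γ∕2`).
FILE 2 (`…N18KernelStepRateKingMechanismRecord`): the record editions `…OfRecord₁₃` and, under the v5 pin, the N18 conjunct at every run length + the (D4) read-out from the sizes.

Sources (TYPES and the mechanism only): C. King, Commun. Math. Phys. **102** (1986) 649–677 [King1986] — Prop. 3.8 (3.71) p. 664, Prop. 3.9 (3.73) p. 665 and the p. 665
sentence quoted above, Lemma 4.5 (4.38) p. 674, (4.41)–(4.43) p. 675; T. Bałaban, Commun. Math. Phys. **109** (1987) 249–301 [Balaban1987RG1] — Thm 1 p. 259 («contained in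
an interval ]0, γ]»: the window; «uniform in the lattice spacing ε»), (1.18) p. 263, (1.20)–(1.22) p. 264, (5.10) p. 293.  No claim about the mass gap.
-/

noncomputable section

namespace YMDAG.N18.KernelStepRateKingMechanism

open scoped BigOperators
open Matrix
open Literature.MathematicalPhysics.QuantumFieldTheory.Balaban1983to89
open Literature.MathematicalPhysics.QuantumFieldTheory.Balaban1983to89.T4Continuum (T4Family ULoop)
open Literature.MathematicalPhysics.QuantumFieldTheory.Balaban1983to89.T4OutputRate (Carriers Functional Window NE5 DecayBound)
open Literature.MathematicalPhysics.QuantumFieldTheory.Balaban1983to89.B12Sec2to5 (l1 l1_nonneg Decay510)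
open Node00 (U3Letters₁₁ TermFamily1 prependCoupling)
open Node00.U3OfKernels (kernelA EA KernelDecay decayBound_EA_iff kernelDecay_of_decayBound)
open Node00.U3KernelLetters (KernelStepRate)
open Summit.QuantumFields.YangMills.BalabanUVNodes.N18KingModelScales (bilin3_rate bilin_decay_bound inv_pow_le_kingTheta_pow)
open Summit.QuantumFields.YangMills.BalabanUVNodes.N18KingModel (kingTheta_pos kingTheta_lt_one)

/-! ## §1 Any carriers: p415038's knit with COUPLED (coupling-reading) and DRESSED (background-reading) factor data -/

section Coupled

variable {C : Carriers} {EA : Functional C C.BgA} {EB : Functional C C.BgB} {W : Set (ℕ → ℝ)}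
  {β : ℕ → Type*} [∀ j, Fintype (β j)] {P : ℕ → Type*}

/-- ★ **KING's (3.73) MECHANISM WITH COUPLED, DRESSED FACTOR DATA.**  Any carriers `C`; a domain `X` of scale `j` reads positions `p X`, `r X` with `C.d X ≤ ρ_j(p X, r X)`;
at couplings `g` and run-B background `U`, run A's output at `X` (background `C.transport U`) is the three-factor read-out `u_A(g,U,X) ⬝ (E_A(g,U,X) v_A(g,U,X))` over the
scale-`j` summation lattice ((4.42)), run B's the `B`-one; sizes `sA, sC, sC, sB`, one-line rates `cA·θ^j, cC·θ^j, cB·θ^j`, common decay `κ` through the positions `q_j`,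
scale-uniform lattice sums `V`, all asked FOR `g ∈ W` ONLY ⟹ `NE5 EA EB W (κ∕2) θ ((cA·sC·sB + sA·cC·sB + sA·sC·cB)·V²)` — ONE `θ` for ALL scales.  p415038's
`ne5_of_threeFactorRates` is the case of `(g, U)`-blind data. [cite: King1986, Prop. 3.9 (3.73) p.665 and (4.42)–(4.43) p.675] -/
theorem ne5_of_threeFactorRates_coupled (ρ : (j : ℕ) → P j → P j → ℝ) (hρ0 : ∀ j p q, 0 ≤ ρ j p q)
    (hρtri : ∀ j p q r, ρ j p r ≤ ρ j p q + ρ j q r) (q : (j : ℕ) → β j → P j)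
    (p r : (X : C.Dom) → P (C.scale X))
    (uA vA uB vB : (ℕ → ℝ) → C.BgB → (X : C.Dom) → β (C.scale X) → ℝ)
    (CA CB : (ℕ → ℝ) → C.BgB → (X : C.Dom) → Matrix (β (C.scale X)) (β (C.scale X)) ℝ)
    {κ θ sA sC sB cA cC cB V : ℝ} (hκ : 0 ≤ κ) (hθ : 0 ≤ θ) (hsA : 0 ≤ sA) (hsC : 0 ≤ sC) (hsB : 0 ≤ sB)
    (hcA : 0 ≤ cA) (hcC : 0 ≤ cC) (hcB : 0 ≤ cB)
    (hu : ∀ g ∈ W, ∀ U X i, |uA g U X i| ≤ sA * Real.exp (-(κ * ρ _ (p X) (q _ i))))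
    (hCA : ∀ g ∈ W, ∀ U X i i', |CA g U X i i'| ≤ sC * Real.exp (-(κ * ρ _ (q _ i) (q _ i'))))
    (hCB : ∀ g ∈ W, ∀ U X i i', |CB g U X i i'| ≤ sC * Real.exp (-(κ * ρ _ (q _ i) (q _ i'))))
    (hv : ∀ g ∈ W, ∀ U X i', |vB g U X i'| ≤ sB * Real.exp (-(κ * ρ _ (q _ i') (r X))))
    (hdu : ∀ g ∈ W, ∀ U X i, |uB g U X i - uA g U X i| ≤ cA * θ ^ C.scale X * Real.exp (-(κ * ρ _ (p X) (q _ i))))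
    (hdC : ∀ g ∈ W, ∀ U X i i',
      |CB g U X i i' - CA g U X i i'| ≤ cC * θ ^ C.scale X * Real.exp (-(κ * ρ _ (q _ i) (q _ i'))))
    (hdv : ∀ g ∈ W, ∀ U X i', |vB g U X i' - vA g U X i'| ≤ cB * θ ^ C.scale X * Real.exp (-(κ * ρ _ (q _ i') (r X))))
    (hV : ∀ j (s : P j), ∑ i, Real.exp (-(κ / 2 * ρ j s (q j i))) ≤ V)
    (hd : ∀ X, C.d X ≤ ρ _ (p X) (r X))
    (hEA : ∀ g ∈ W, ∀ U X, EA g (C.transport U) X = uA g U X ⬝ᵥ (CA g U X *ᵥ vA g U X))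
    (hEB : ∀ g ∈ W, ∀ U X, EB g U X = uB g U X ⬝ᵥ (CB g U X *ᵥ vB g U X)) :
    NE5 EA EB W (κ / 2) θ ((cA * sC * sB + sA * cC * sB + sA * sC * cB) * V ^ 2) := by
  intro g hg U X
  rw [hEA g hg U X, hEB g hg U X, abs_sub_comm]
  have hθj : 0 ≤ θ ^ C.scale X := pow_nonneg hθ _
  have h := bilin3_rate (ρ (C.scale X)) (hρ0 _) (hρtri _) (q _) (p X) (r X) (uA g U X) (uB g U X) (vA g U X) (vB g U X)
    (CA g U X) (CB g U X) hκ hsA hsC hsB (mul_nonneg hcA hθj) (mul_nonneg hcC hθj) (mul_nonneg hcB hθj)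
    (hu g hg U X) (hCA g hg U X) (hCB g hg U X) (hv g hg U X) (hdu g hg U X) (hdC g hg U X) (hdv g hg U X) (hV _)
  refine h.trans ?_
  have hK : 0 ≤ (cA * sC * sB + sA * cC * sB + sA * sC * cB) * V ^ 2 * θ ^ C.scale X := by positivity
  have hexp : Real.exp (-(κ / 2 * ρ _ (p X) (r X))) ≤ Real.exp (-(κ / 2 * C.d X)) :=
    Real.exp_le_exp.mpr (neg_le_neg (mul_le_mul_of_nonneg_left (hd X) (by positivity)))
  calc (cA * θ ^ C.scale X * sC * sB + sA * (cC * θ ^ C.scale X) * sB + sA * sC * (cB * θ ^ C.scale X)) * V ^ 2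
          * Real.exp (-(κ / 2 * ρ _ (p X) (r X)))
      = (cA * sC * sB + sA * cC * sB + sA * sC * cB) * V ^ 2 * θ ^ C.scale X
          * Real.exp (-(κ / 2 * ρ _ (p X) (r X))) := by ring
    _ ≤ (cA * sC * sB + sA * cC * sB + sA * sC * cB) * V ^ 2 * θ ^ C.scale X * Real.exp (-(κ / 2 * C.d X)) :=
        mul_le_mul_of_nonneg_left hexp hK

/-- **THE UNDIFFERENCED SIZES GIVE NODE U3's OWN DECAY SLOT** ((0.25)∕(1.18) shape with a UNIFORM constant): a three-factor read-out `u_A ⬝ (E_A v_A)` with sizes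
`sA, sC, sB`, decay `κ` through the positions and lattice sums `V`, for `g ∈ W`, has `|E_A(g, U, X)| ≤ sA·sC·sB·V²·e^{−(κ∕2) d(X)}` — `DecayBound EA W (sA·sC·sB·V²) (κ∕2)`
(p415038's `bilin_decay_bound`, (4.41)'s engine). [cite: King1986, (4.41) p.675; Balaban1987RG1, (1.18) p.263] -/
theorem decayBound_of_threeFactorSizes_coupled (ρ : (j : ℕ) → P j → P j → ℝ) (hρ0 : ∀ j p q, 0 ≤ ρ j p q)
    (hρtri : ∀ j p q r, ρ j p r ≤ ρ j p q + ρ j q r) (q : (j : ℕ) → β j → P j)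
    (p r : (X : C.Dom) → P (C.scale X))
    (uA vA : (ℕ → ℝ) → C.BgA → (X : C.Dom) → β (C.scale X) → ℝ)
    (CA : (ℕ → ℝ) → C.BgA → (X : C.Dom) → Matrix (β (C.scale X)) (β (C.scale X)) ℝ)
    {κ sA sC sB V : ℝ} (hκ : 0 ≤ κ) (hsA : 0 ≤ sA) (hsC : 0 ≤ sC) (hsB : 0 ≤ sB)
    (hu : ∀ g ∈ W, ∀ U X i, |uA g U X i| ≤ sA * Real.exp (-(κ * ρ _ (p X) (q _ i))))
    (hCA : ∀ g ∈ W, ∀ U X i i', |CA g U X i i'| ≤ sC * Real.exp (-(κ * ρ _ (q _ i) (q _ i'))))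
    (hvA : ∀ g ∈ W, ∀ U X i', |vA g U X i'| ≤ sB * Real.exp (-(κ * ρ _ (q _ i') (r X))))
    (hV : ∀ j (s : P j), ∑ i, Real.exp (-(κ / 2 * ρ j s (q j i))) ≤ V)
    (hd : ∀ X, C.d X ≤ ρ _ (p X) (r X))
    (hEA : ∀ g ∈ W, ∀ U X, EA g U X = uA g U X ⬝ᵥ (CA g U X *ᵥ vA g U X)) :
    DecayBound EA W (sA * sC * sB * V ^ 2) (κ / 2) := by
  intro g hg U X
  rw [hEA g hg U X]
  refine (bilin_decay_bound (ρ (C.scale X)) (hρ0 _) (hρtri _) (q _) (p X) (r X) (uA g U X) (vA g U X) (CA g U X)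
    hκ hsA hsC hsB (hu g hg U X) (hCA g hg U X) (hvA g hg U X) (hV _)).trans ?_
  have hK : 0 ≤ sA * sC * sB * V ^ 2 := by positivity
  exact mul_le_mul_of_nonneg_left
    (Real.exp_le_exp.mpr (neg_le_neg (mul_le_mul_of_nonneg_left (hd X) (by positivity)))) hK

end Coupled

/-! ## §2 Kernel currency (generic term family): the three-factor mechanism ⟹ W1-19b's `KernelStepRate`; the sizes ⟹ `DecayBound (EA …)` and `KernelDecay` -/

section Kernel

variable {𝔄 : Type*} [NormedRing 𝔄] [NormedAlgebra ℝ 𝔄]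
variable {V𝔳 : Type*} [NormedAddCommGroup V𝔳] [NormedSpace ℝ V𝔳] {ι : Type*} [Fintype ι]
variable (F : T4Family) (ℰ : TermFamily1 F 𝔄) (ρ : V𝔳 →L[ℝ] 𝔄) (bV : Module.Basis ι ℝ V𝔳)
variable {β : ℕ → Type*} [∀ k, Fintype (β k)] {P : ℕ → Type*}

/-- ★★ **KING's MECHANISM PRODUCES THE N18 LETTER.**  If, on the window `]0, γ]^ℕ`, run A's limiting level-`(k+1)` kernel `Π_{k+1,μν}(g; z) = kernelA g k μ ν z` is a
three-factor read-out `u_A ⬝ (E_A v_A)` over a level-`k` summation lattice `β k` (positions `q k`), run B's RE-INDEXED kernel `Π_{k+2,μν}(b, g; z) = kernelA (b, g) (k+1) μ ν z`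
(every unpaired first coupling `b ∈ ]0, γ]`) the `B`-one over the SAME lattice, with read positions `p, r` of the entry `(μ, ν, z)` at pseudo-distance `≥ |z|₁`, sizes
`sA` (row), `sC` (both middles), `sB` (run B's column), ONE-LINE RATES `cA·θ₅^{k+1}`, `cC·θ₅^{k+1}`, `cB·θ₅^{k+1}` («the same graph with a difference of propagators on one
line»), decay `κ` through the positions and lattice sums `≤ V`, then `KernelStepRate F ℰ ρ bV γ (κ∕2) θ₅ ((cA·sC·sB + sA·cC·sB + sA·sC·cB)·V²)`: (4.43) entry by entry.
[cite: King1986, Prop. 3.9 (3.73) p.665 and (4.42)–(4.43) p.675; Balaban1987RG1, Thm 1 p.259 and (1.20)–(1.22) p.264] -/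
theorem kernelStepRate_of_threeFactorRates
    (ρd : (k : ℕ) → P k → P k → ℝ) (hρ0 : ∀ k p q, 0 ≤ ρd k p q) (hρtri : ∀ k p q r, ρd k p r ≤ ρd k p q + ρd k q r)
    (q : (k : ℕ) → β k → P k) (p r : (k : ℕ) → Fin 4 → Fin 4 → (Fin 4 → ℤ) → P k)
    (uA vA : (ℕ → ℝ) → (k : ℕ) → Fin 4 → Fin 4 → (Fin 4 → ℤ) → β k → ℝ)
    (CA : (ℕ → ℝ) → (k : ℕ) → Fin 4 → Fin 4 → (Fin 4 → ℤ) → Matrix (β k) (β k) ℝ)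
    (uB vB : ℝ → (ℕ → ℝ) → (k : ℕ) → Fin 4 → Fin 4 → (Fin 4 → ℤ) → β k → ℝ)
    (CB : ℝ → (ℕ → ℝ) → (k : ℕ) → Fin 4 → Fin 4 → (Fin 4 → ℤ) → Matrix (β k) (β k) ℝ)
    {γ κ θ₅ sA sC sB cA cC cB V : ℝ} (hκ : 0 ≤ κ) (hθ : 0 ≤ θ₅) (hsA : 0 ≤ sA) (hsC : 0 ≤ sC) (hsB : 0 ≤ sB)
    (hcA : 0 ≤ cA) (hcC : 0 ≤ cC) (hcB : 0 ≤ cB)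
    (hEA : ∀ g ∈ Window γ, ∀ (k : ℕ) (μ ν : Fin 4) (z : Fin 4 → ℤ),
      kernelA F ℰ ρ bV g k μ ν z = uA g k μ ν z ⬝ᵥ (CA g k μ ν z *ᵥ vA g k μ ν z))
    (hEB : ∀ b : ℝ, 0 < b → b ≤ γ → ∀ g ∈ Window γ, ∀ (k : ℕ) (μ ν : Fin 4) (z : Fin 4 → ℤ),
      kernelA F ℰ ρ bV (prependCoupling b g) (k + 1) μ ν z = uB b g k μ ν z ⬝ᵥ (CB b g k μ ν z *ᵥ vB b g k μ ν z))
    (hu : ∀ g ∈ Window γ, ∀ (k : ℕ) (μ ν : Fin 4) (z : Fin 4 → ℤ) (i : β k),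
      |uA g k μ ν z i| ≤ sA * Real.exp (-(κ * ρd k (p k μ ν z) (q k i))))
    (hCA : ∀ g ∈ Window γ, ∀ (k : ℕ) (μ ν : Fin 4) (z : Fin 4 → ℤ) (i i' : β k),
      |CA g k μ ν z i i'| ≤ sC * Real.exp (-(κ * ρd k (q k i) (q k i'))))
    (hCB : ∀ b : ℝ, 0 < b → b ≤ γ → ∀ g ∈ Window γ, ∀ (k : ℕ) (μ ν : Fin 4) (z : Fin 4 → ℤ) (i i' : β k),
      |CB b g k μ ν z i i'| ≤ sC * Real.exp (-(κ * ρd k (q k i) (q k i'))))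
    (hv : ∀ b : ℝ, 0 < b → b ≤ γ → ∀ g ∈ Window γ, ∀ (k : ℕ) (μ ν : Fin 4) (z : Fin 4 → ℤ) (i' : β k),
      |vB b g k μ ν z i'| ≤ sB * Real.exp (-(κ * ρd k (q k i') (r k μ ν z))))
    (hdu : ∀ b : ℝ, 0 < b → b ≤ γ → ∀ g ∈ Window γ, ∀ (k : ℕ) (μ ν : Fin 4) (z : Fin 4 → ℤ) (i : β k),
      |uB b g k μ ν z i - uA g k μ ν z i| ≤ cA * θ₅ ^ (k + 1) * Real.exp (-(κ * ρd k (p k μ ν z) (q k i))))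
    (hdC : ∀ b : ℝ, 0 < b → b ≤ γ → ∀ g ∈ Window γ, ∀ (k : ℕ) (μ ν : Fin 4) (z : Fin 4 → ℤ) (i i' : β k),
      |CB b g k μ ν z i i' - CA g k μ ν z i i'| ≤ cC * θ₅ ^ (k + 1) * Real.exp (-(κ * ρd k (q k i) (q k i'))))
    (hdv : ∀ b : ℝ, 0 < b → b ≤ γ → ∀ g ∈ Window γ, ∀ (k : ℕ) (μ ν : Fin 4) (z : Fin 4 → ℤ) (i' : β k),
      |vB b g k μ ν z i' - vA g k μ ν z i'| ≤ cB * θ₅ ^ (k + 1) * Real.exp (-(κ * ρd k (q k i') (r k μ ν z))))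
    (hV : ∀ (k : ℕ) (s : P k), ∑ i, Real.exp (-(κ / 2 * ρd k s (q k i))) ≤ V)
    (hd : ∀ (k : ℕ) (μ ν : Fin 4) (z : Fin 4 → ℤ), l1 z ≤ ρd k (p k μ ν z) (r k μ ν z)) :
    KernelStepRate F ℰ ρ bV γ (κ / 2) θ₅ ((cA * sC * sB + sA * cC * sB + sA * sC * cB) * V ^ 2) := by
  intro b hb hbγ g hg k μ ν z
  rw [hEA g hg k μ ν z, hEB b hb hbγ g hg k μ ν z, abs_sub_comm]
  have hθj : 0 ≤ θ₅ ^ (k + 1) := pow_nonneg hθ _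
  have h := bilin3_rate (ρd k) (hρ0 k) (hρtri k) (q k) (p k μ ν z) (r k μ ν z) (uA g k μ ν z) (uB b g k μ ν z)
    (vA g k μ ν z) (vB b g k μ ν z) (CA g k μ ν z) (CB b g k μ ν z) hκ hsA hsC hsB
    (mul_nonneg hcA hθj) (mul_nonneg hcC hθj) (mul_nonneg hcB hθj)
    (hu g hg k μ ν z) (hCA g hg k μ ν z) (hCB b hb hbγ g hg k μ ν z) (hv b hb hbγ g hg k μ ν z)
    (hdu b hb hbγ g hg k μ ν z) (hdC b hb hbγ g hg k μ ν z) (hdv b hb hbγ g hg k μ ν z) (hV k)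
  refine h.trans ?_
  have hK : 0 ≤ (cA * sC * sB + sA * cC * sB + sA * sC * cB) * V ^ 2 * θ₅ ^ (k + 1) := by positivity
  have hexp : Real.exp (-(κ / 2 * ρd k (p k μ ν z) (r k μ ν z))) ≤ Real.exp (-(κ / 2 * l1 z)) :=
    Real.exp_le_exp.mpr (neg_le_neg (mul_le_mul_of_nonneg_left (hd k μ ν z) (by positivity)))
  calc (cA * θ₅ ^ (k + 1) * sC * sB + sA * (cC * θ₅ ^ (k + 1)) * sB + sA * sC * (cB * θ₅ ^ (k + 1))) * V ^ 2
          * Real.exp (-(κ / 2 * ρd k (p k μ ν z) (r k μ ν z)))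
      = (cA * sC * sB + sA * cC * sB + sA * sC * cB) * V ^ 2 * θ₅ ^ (k + 1)
          * Real.exp (-(κ / 2 * ρd k (p k μ ν z) (r k μ ν z))) := by ring
    _ ≤ (cA * sC * sB + sA * cC * sB + sA * sC * cB) * V ^ 2 * θ₅ ^ (k + 1) * Real.exp (-(κ / 2 * l1 z)) :=
        mul_le_mul_of_nonneg_left hexp hK

/-- **RUN A's SIZES BOUND THE LIMITING KERNEL ENTRY**: `|Π_{k+1,μν}(g; z)| ≤ sA·sC·sB·V²·e^{−(κ∕2)|z|₁}` for `g` in the window ((4.41) through positions).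
[cite: King1986, (4.41) p.675; Balaban1987RG1, (5.10) p.293] -/
theorem abs_kernelA_le_of_threeFactorSizes
    (ρd : (k : ℕ) → P k → P k → ℝ) (hρ0 : ∀ k p q, 0 ≤ ρd k p q) (hρtri : ∀ k p q r, ρd k p r ≤ ρd k p q + ρd k q r)
    (q : (k : ℕ) → β k → P k) (p r : (k : ℕ) → Fin 4 → Fin 4 → (Fin 4 → ℤ) → P k)
    (uA vA : (ℕ → ℝ) → (k : ℕ) → Fin 4 → Fin 4 → (Fin 4 → ℤ) → β k → ℝ)
    (CA : (ℕ → ℝ) → (k : ℕ) → Fin 4 → Fin 4 → (Fin 4 → ℤ) → Matrix (β k) (β k) ℝ)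
    {γ κ sA sC sB V : ℝ} (hκ : 0 ≤ κ) (hsA : 0 ≤ sA) (hsC : 0 ≤ sC) (hsB : 0 ≤ sB)
    (hEA : ∀ g ∈ Window γ, ∀ (k : ℕ) (μ ν : Fin 4) (z : Fin 4 → ℤ),
      kernelA F ℰ ρ bV g k μ ν z = uA g k μ ν z ⬝ᵥ (CA g k μ ν z *ᵥ vA g k μ ν z))
    (hu : ∀ g ∈ Window γ, ∀ (k : ℕ) (μ ν : Fin 4) (z : Fin 4 → ℤ) (i : β k),
      |uA g k μ ν z i| ≤ sA * Real.exp (-(κ * ρd k (p k μ ν z) (q k i))))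
    (hCA : ∀ g ∈ Window γ, ∀ (k : ℕ) (μ ν : Fin 4) (z : Fin 4 → ℤ) (i i' : β k),
      |CA g k μ ν z i i'| ≤ sC * Real.exp (-(κ * ρd k (q k i) (q k i'))))
    (hvA : ∀ g ∈ Window γ, ∀ (k : ℕ) (μ ν : Fin 4) (z : Fin 4 → ℤ) (i' : β k),
      |vA g k μ ν z i'| ≤ sB * Real.exp (-(κ * ρd k (q k i') (r k μ ν z))))
    (hV : ∀ (k : ℕ) (s : P k), ∑ i, Real.exp (-(κ / 2 * ρd k s (q k i))) ≤ V)
    (hd : ∀ (k : ℕ) (μ ν : Fin 4) (z : Fin 4 → ℤ), l1 z ≤ ρd k (p k μ ν z) (r k μ ν z))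
    {g : ℕ → ℝ} (hg : g ∈ Window γ) (k : ℕ) (μ ν : Fin 4) (z : Fin 4 → ℤ) :
    |kernelA F ℰ ρ bV g k μ ν z| ≤ sA * sC * sB * V ^ 2 * Real.exp (-(κ / 2 * l1 z)) := by
  rw [hEA g hg k μ ν z]
  refine (bilin_decay_bound (ρd k) (hρ0 k) (hρtri k) (q k) (p k μ ν z) (r k μ ν z) (uA g k μ ν z) (vA g k μ ν z)
    (CA g k μ ν z) hκ hsA hsC hsB (hu g hg k μ ν z) (hCA g hg k μ ν z) (hvA g hg k μ ν z) (hV k)).trans ?_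
  have hK : 0 ≤ sA * sC * sB * V ^ 2 := by positivity
  exact mul_le_mul_of_nonneg_left
    (Real.exp_le_exp.mpr (neg_le_neg (mul_le_mul_of_nonneg_left (hd k μ ν z) (by positivity)))) hK

/-- ★ **RUN A's SIZES GIVE NODE U3's DECAY SLOT AT THE KERNEL OBJECTS WITH A UNIFORM CONSTANT**: `DecayBound (EA F ℰ ρ bV) (Window γ) (sA·sC·sB·V²) (κ∕2)` — the
(0.25)∕(1.18)-shaped letter whose UNIFORMITY in the level is what dag-n18-w1's `scaleShiftRate_betaMerged_of_n18At_objects_of_decayBound` reads for N17 ((UD)).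
[cite: King1986, (4.41) p.675; Balaban1987RG1, (1.18) p.263] -/
theorem decayBound_EA_of_threeFactorSizes
    (ρd : (k : ℕ) → P k → P k → ℝ) (hρ0 : ∀ k p q, 0 ≤ ρd k p q) (hρtri : ∀ k p q r, ρd k p r ≤ ρd k p q + ρd k q r)
    (q : (k : ℕ) → β k → P k) (p r : (k : ℕ) → Fin 4 → Fin 4 → (Fin 4 → ℤ) → P k)
    (uA vA : (ℕ → ℝ) → (k : ℕ) → Fin 4 → Fin 4 → (Fin 4 → ℤ) → β k → ℝ)
    (CA : (ℕ → ℝ) → (k : ℕ) → Fin 4 → Fin 4 → (Fin 4 → ℤ) → Matrix (β k) (β k) ℝ)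
    {γ κ sA sC sB V : ℝ} (hκ : 0 ≤ κ) (hsA : 0 ≤ sA) (hsC : 0 ≤ sC) (hsB : 0 ≤ sB)
    (hEA : ∀ g ∈ Window γ, ∀ (k : ℕ) (μ ν : Fin 4) (z : Fin 4 → ℤ),
      kernelA F ℰ ρ bV g k μ ν z = uA g k μ ν z ⬝ᵥ (CA g k μ ν z *ᵥ vA g k μ ν z))
    (hu : ∀ g ∈ Window γ, ∀ (k : ℕ) (μ ν : Fin 4) (z : Fin 4 → ℤ) (i : β k),
      |uA g k μ ν z i| ≤ sA * Real.exp (-(κ * ρd k (p k μ ν z) (q k i))))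
    (hCA : ∀ g ∈ Window γ, ∀ (k : ℕ) (μ ν : Fin 4) (z : Fin 4 → ℤ) (i i' : β k),
      |CA g k μ ν z i i'| ≤ sC * Real.exp (-(κ * ρd k (q k i) (q k i'))))
    (hvA : ∀ g ∈ Window γ, ∀ (k : ℕ) (μ ν : Fin 4) (z : Fin 4 → ℤ) (i' : β k),
      |vA g k μ ν z i'| ≤ sB * Real.exp (-(κ * ρd k (q k i') (r k μ ν z))))
    (hV : ∀ (k : ℕ) (s : P k), ∑ i, Real.exp (-(κ / 2 * ρd k s (q k i))) ≤ V)
    (hd : ∀ (k : ℕ) (μ ν : Fin 4) (z : Fin 4 → ℤ), l1 z ≤ ρd k (p k μ ν z) (r k μ ν z)) :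
    DecayBound (EA F ℰ ρ bV) (Window γ) (sA * sC * sB * V ^ 2) (κ / 2) := by
  refine (decayBound_EA_iff F ℰ ρ bV _ _ _).2 fun g hg k μ ν z => ?_
  rw [neg_mul]
  exact abs_kernelA_le_of_threeFactorSizes F ℰ ρ bV ρd hρ0 hρtri q p r uA vA CA hκ hsA hsC hsB hEA hu hCA hvA hV hd hg k μ ν z

/-- ★ **… HENCE THE (5.10) CLASS LETTER** `KernelDecay F ℰ ρ bV (Window γ) μ ν (κ∕2)` at every direction pair — W1-19's run-A decay clause, the `hdec` input of the (D4)
read-out at the kernel objects (`kernelDecay_of_decayBound`). [cite: Balaban1987RG1, (5.10) p.293; King1986, (4.41) p.675] -/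
theorem kernelDecay_of_threeFactorSizes
    (ρd : (k : ℕ) → P k → P k → ℝ) (hρ0 : ∀ k p q, 0 ≤ ρd k p q) (hρtri : ∀ k p q r, ρd k p r ≤ ρd k p q + ρd k q r)
    (q : (k : ℕ) → β k → P k) (p r : (k : ℕ) → Fin 4 → Fin 4 → (Fin 4 → ℤ) → P k)
    (uA vA : (ℕ → ℝ) → (k : ℕ) → Fin 4 → Fin 4 → (Fin 4 → ℤ) → β k → ℝ)
    (CA : (ℕ → ℝ) → (k : ℕ) → Fin 4 → Fin 4 → (Fin 4 → ℤ) → Matrix (β k) (β k) ℝ)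
    {γ κ sA sC sB V : ℝ} (hκ : 0 ≤ κ) (hsA : 0 ≤ sA) (hsC : 0 ≤ sC) (hsB : 0 ≤ sB)
    (hEA : ∀ g ∈ Window γ, ∀ (k : ℕ) (μ ν : Fin 4) (z : Fin 4 → ℤ),
      kernelA F ℰ ρ bV g k μ ν z = uA g k μ ν z ⬝ᵥ (CA g k μ ν z *ᵥ vA g k μ ν z))
    (hu : ∀ g ∈ Window γ, ∀ (k : ℕ) (μ ν : Fin 4) (z : Fin 4 → ℤ) (i : β k),
      |uA g k μ ν z i| ≤ sA * Real.exp (-(κ * ρd k (p k μ ν z) (q k i))))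
    (hCA : ∀ g ∈ Window γ, ∀ (k : ℕ) (μ ν : Fin 4) (z : Fin 4 → ℤ) (i i' : β k),
      |CA g k μ ν z i i'| ≤ sC * Real.exp (-(κ * ρd k (q k i) (q k i'))))
    (hvA : ∀ g ∈ Window γ, ∀ (k : ℕ) (μ ν : Fin 4) (z : Fin 4 → ℤ) (i' : β k),
      |vA g k μ ν z i'| ≤ sB * Real.exp (-(κ * ρd k (q k i') (r k μ ν z))))
    (hV : ∀ (k : ℕ) (s : P k), ∑ i, Real.exp (-(κ / 2 * ρd k s (q k i))) ≤ V)
    (hd : ∀ (k : ℕ) (μ ν : Fin 4) (z : Fin 4 → ℤ), l1 z ≤ ρd k (p k μ ν z) (r k μ ν z)) (μ ν : Fin 4) :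
    KernelDecay F ℰ ρ bV (Window γ) μ ν (κ / 2) :=
  kernelDecay_of_decayBound F ℰ ρ bV
    (decayBound_EA_of_threeFactorSizes F ℰ ρ bV ρd hρ0 hρtri q p r uA vA CA hκ hsA hsC hsB hEA hu hCA hvA hV hd) μ ν

variable {ℰ}

/-- **MONOTONICITY OF THE N18 LETTER** in its four letters: a smaller window radius `γ' ≤ γ`, a weaker decay `κ' ≤ κ`, a larger ratio `θ₅ ≤ θ₅'` (`θ₅ ≥ 0`) and a larger
constant `C₅ ≤ C₅'` (`C₅' ≥ 0`) keep the letter — how a letter block DOMINATING the mechanism's letters inherits it. [cite: Balaban1987RG1, Thm 1 p.259 and (1.20)–(1.22) p.264 (bookkeeping)] -/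
theorem kernelStepRate_mono {γ γ' κ κ' θ₅ θ₅' C₅ C₅' : ℝ} (h : KernelStepRate F ℰ ρ bV γ κ θ₅ C₅) (hγ : γ' ≤ γ) (hκ : κ' ≤ κ)
    (hθ0 : 0 ≤ θ₅) (hθ : θ₅ ≤ θ₅') (hC : C₅ ≤ C₅') (hC0 : 0 ≤ C₅') : KernelStepRate F ℰ ρ bV γ' κ' θ₅' C₅' := by
  intro b hb hbγ g hg k μ ν z
  have hg' : g ∈ Window γ := fun i => ⟨(hg i).1, (hg i).2.trans hγ⟩
  refine (h b hb (hbγ.trans hγ) g hg' k μ ν z).trans ?_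
  have h1 : C₅ * θ₅ ^ (k + 1) ≤ C₅' * θ₅' ^ (k + 1) :=
    (mul_le_mul_of_nonneg_right hC (pow_nonneg hθ0 _)).trans
      (mul_le_mul_of_nonneg_left (pow_le_pow_left₀ hθ0 hθ _) hC0)
  have h2 : Real.exp (-(κ * l1 z)) ≤ Real.exp (-(κ' * l1 z)) :=
    Real.exp_le_exp.mpr (neg_le_neg (mul_le_mul_of_nonneg_right hκ (l1_nonneg z)))
  exact mul_le_mul h1 h2 (Real.exp_pos _).le (mul_nonneg hC0 (pow_nonneg (hθ0.trans hθ) _))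

/-- **THE (5.10) CLASS LETTER IS ANTITONE IN THE RATE**: `KernelDecay … κ` and `κ' ≤ κ` give `KernelDecay … κ'` (same constants; a constant meeting (5.10) is `≥ 0`).
[cite: Balaban1987RG1, (5.10) p.293 (bookkeeping)] -/
theorem kernelDecay_anti {W : Set (ℕ → ℝ)} {μ ν : Fin 4} {κ κ' : ℝ} (h : KernelDecay F ℰ ρ bV W μ ν κ) (hκ : κ' ≤ κ) :
    KernelDecay F ℰ ρ bV W μ ν κ' := by
  intro g hg
  obtain ⟨C₀, hC⟩ := h g hg
  refine ⟨C₀, fun k z => (hC k z).trans ?_⟩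
  have hC0 : 0 ≤ C₀ := (mul_nonneg_iff_of_pos_right (Real.exp_pos _)).1 ((abs_nonneg _).trans (hC k z))
  exact mul_le_mul_of_nonneg_left (Real.exp_le_exp.mpr (by nlinarith [l1_nonneg z])) hC0

end Kernel

/-! ## §3 KING-MODEL SCALES: outer lines at Prop. 3.8's rate `L^{−α(k+1)}`, middle line at Lemma 4.5's `L^{−(k+1)}` ⟹ ONE `θ₅ = L^{−α}` -/

section KingScales

variable {𝔄 : Type*} [NormedRing 𝔄] [NormedAlgebra ℝ 𝔄]
variable {V𝔳 : Type*} [NormedAddCommGroup V𝔳] [NormedSpace ℝ V𝔳] {ι : Type*} [Fintype ι]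
variable (F : T4Family) (ℰ : TermFamily1 F 𝔄) (ρ : V𝔳 →L[ℝ] 𝔄) (bV : Module.Basis ι ℝ V𝔳)
variable {β : ℕ → Type*} [∀ k, Fintype (β k)] {P : ℕ → Type*}

/-- ★★ **THE N18 LETTER AT KING-MODEL SCALES.**  The three-factor mechanism of `kernelStepRate_of_threeFactorRates` with the one-line rates AS KING PRINTS THEM —
outer lines (minimiser rows ∕ columns, Prop. 3.8 (3.71)) at `cA·(L^{−α})^{k+1}`, `cB·(L^{−α})^{k+1}`, middle line (covariance, Lemma 4.5 (4.38)) at `cC·(L^{k+1})⁻¹` — and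
`L ≥ 1`, `α ≤ 1` gives the letter with ONE ratio `θ₅ = L^{−α}` (`(L^{k+1})⁻¹ ≤ (L^{−α})^{k+1}`, p415038 `inv_pow_le_kingTheta_pow`), decay `κ∕2`, constant
`(cA·sC·sB + sA·cC·sB + sA·sC·cB)·V²`. [cite: King1986, Prop. 3.8 (3.71) p.664, Prop. 3.9 (3.73) p.665, Lemma 4.5 (4.38) p.674 and (4.42)–(4.43) p.675; Balaban1987RG1, Thm 1 p.259] -/
theorem kernelStepRate_of_threeFactorRates_kingScales {L : ℕ} (hL : 1 ≤ L) {α : ℝ} (hα1 : α ≤ 1)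
    (ρd : (k : ℕ) → P k → P k → ℝ) (hρ0 : ∀ k p q, 0 ≤ ρd k p q) (hρtri : ∀ k p q r, ρd k p r ≤ ρd k p q + ρd k q r)
    (q : (k : ℕ) → β k → P k) (p r : (k : ℕ) → Fin 4 → Fin 4 → (Fin 4 → ℤ) → P k)
    (uA vA : (ℕ → ℝ) → (k : ℕ) → Fin 4 → Fin 4 → (Fin 4 → ℤ) → β k → ℝ)
    (CA : (ℕ → ℝ) → (k : ℕ) → Fin 4 → Fin 4 → (Fin 4 → ℤ) → Matrix (β k) (β k) ℝ)
    (uB vB : ℝ → (ℕ → ℝ) → (k : ℕ) → Fin 4 → Fin 4 → (Fin 4 → ℤ) → β k → ℝ)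
    (CB : ℝ → (ℕ → ℝ) → (k : ℕ) → Fin 4 → Fin 4 → (Fin 4 → ℤ) → Matrix (β k) (β k) ℝ)
    {γ κ sA sC sB cA cC cB V : ℝ} (hκ : 0 ≤ κ) (hsA : 0 ≤ sA) (hsC : 0 ≤ sC) (hsB : 0 ≤ sB)
    (hcA : 0 ≤ cA) (hcC : 0 ≤ cC) (hcB : 0 ≤ cB)
    (hEA : ∀ g ∈ Window γ, ∀ (k : ℕ) (μ ν : Fin 4) (z : Fin 4 → ℤ),
      kernelA F ℰ ρ bV g k μ ν z = uA g k μ ν z ⬝ᵥ (CA g k μ ν z *ᵥ vA g k μ ν z))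
    (hEB : ∀ b : ℝ, 0 < b → b ≤ γ → ∀ g ∈ Window γ, ∀ (k : ℕ) (μ ν : Fin 4) (z : Fin 4 → ℤ),
      kernelA F ℰ ρ bV (prependCoupling b g) (k + 1) μ ν z = uB b g k μ ν z ⬝ᵥ (CB b g k μ ν z *ᵥ vB b g k μ ν z))
    (hu : ∀ g ∈ Window γ, ∀ (k : ℕ) (μ ν : Fin 4) (z : Fin 4 → ℤ) (i : β k),
      |uA g k μ ν z i| ≤ sA * Real.exp (-(κ * ρd k (p k μ ν z) (q k i))))
    (hCA : ∀ g ∈ Window γ, ∀ (k : ℕ) (μ ν : Fin 4) (z : Fin 4 → ℤ) (i i' : β k),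
      |CA g k μ ν z i i'| ≤ sC * Real.exp (-(κ * ρd k (q k i) (q k i'))))
    (hCB : ∀ b : ℝ, 0 < b → b ≤ γ → ∀ g ∈ Window γ, ∀ (k : ℕ) (μ ν : Fin 4) (z : Fin 4 → ℤ) (i i' : β k),
      |CB b g k μ ν z i i'| ≤ sC * Real.exp (-(κ * ρd k (q k i) (q k i'))))
    (hv : ∀ b : ℝ, 0 < b → b ≤ γ → ∀ g ∈ Window γ, ∀ (k : ℕ) (μ ν : Fin 4) (z : Fin 4 → ℤ) (i' : β k),
      |vB b g k μ ν z i'| ≤ sB * Real.exp (-(κ * ρd k (q k i') (r k μ ν z))))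
    (hdu : ∀ b : ℝ, 0 < b → b ≤ γ → ∀ g ∈ Window γ, ∀ (k : ℕ) (μ ν : Fin 4) (z : Fin 4 → ℤ) (i : β k),
      |uB b g k μ ν z i - uA g k μ ν z i| ≤
        cA * ((L : ℝ) ^ (-α)) ^ (k + 1) * Real.exp (-(κ * ρd k (p k μ ν z) (q k i))))
    (hdC : ∀ b : ℝ, 0 < b → b ≤ γ → ∀ g ∈ Window γ, ∀ (k : ℕ) (μ ν : Fin 4) (z : Fin 4 → ℤ) (i i' : β k),
      |CB b g k μ ν z i i' - CA g k μ ν z i i'| ≤ cC * ((L : ℝ) ^ (k + 1))⁻¹ * Real.exp (-(κ * ρd k (q k i) (q k i'))))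
    (hdv : ∀ b : ℝ, 0 < b → b ≤ γ → ∀ g ∈ Window γ, ∀ (k : ℕ) (μ ν : Fin 4) (z : Fin 4 → ℤ) (i' : β k),
      |vB b g k μ ν z i' - vA g k μ ν z i'| ≤
        cB * ((L : ℝ) ^ (-α)) ^ (k + 1) * Real.exp (-(κ * ρd k (q k i') (r k μ ν z))))
    (hV : ∀ (k : ℕ) (s : P k), ∑ i, Real.exp (-(κ / 2 * ρd k s (q k i))) ≤ V)
    (hd : ∀ (k : ℕ) (μ ν : Fin 4) (z : Fin 4 → ℤ), l1 z ≤ ρd k (p k μ ν z) (r k μ ν z)) :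
    KernelStepRate F ℰ ρ bV γ (κ / 2) ((L : ℝ) ^ (-α)) ((cA * sC * sB + sA * cC * sB + sA * sC * cB) * V ^ 2) :=
  kernelStepRate_of_threeFactorRates F ℰ ρ bV ρd hρ0 hρtri q p r uA vA CA uB vB CB hκ (kingTheta_pos hL α).le hsA hsC hsB
    hcA hcC hcB hEA hEB hu hCA hCB hv hdu
    (fun b hb hbγ g hg k μ ν z i i' => (hdC b hb hbγ g hg k μ ν z i i').trans
      (mul_le_mul_of_nonneg_right (mul_le_mul_of_nonneg_left (inv_pow_le_kingTheta_pow hL hα1 (k + 1)) hcC)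
        (Real.exp_pos _).le))
    hdv hV hd

/-- **THE KING-SCALES LETTER BLOCK HAS THE SIGNS OF RECORD** (`L ≥ 2`, `α > 0`): decay `κ ≥ 0`, ratio `θ₅ = L^{−α} ∈ ]0, 1[`, constant `C₅ ≥ 0`, fading letters
`0 ≤ C₉`, `0 ≤ ω`, read-out constant `0 ≤ cr` and joint rate `max(L^{−α}, ω) ≤ ρ < 1` give `U3Letters₁₁.Signs` — the α-form of p583713's `kingModel_letters_signs`
(there `α = γ∕2`); the rows the (D4) read-out and N22's fading pin display. [cite: King1986, Prop. 3.9 (3.73) p.665; Balaban1987RG1, (1.20)–(1.22) p.264] -/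
theorem kingScales_letters_signs {L : ℕ} (hL : 2 ≤ L) {α : ℝ} (hα : 0 < α) {κ C₅ C₉ ω cr ρr : ℝ} (hκ : 0 ≤ κ) (hC₅ : 0 ≤ C₅)
    (hC₉ : 0 ≤ C₉) (hω0 : 0 ≤ ω) (hcr : 0 ≤ cr) (hθρ : (L : ℝ) ^ (-α) ≤ ρr) (hωρ : ω ≤ ρr) (hρ : ρr < 1) :
    (⟨κ, (L : ℝ) ^ (-α), C₅, C₉, ω, cr, ρr⟩ : U3Letters₁₁).Signs where
  κ_nonneg := hκ
  θ₅_pos := kingTheta_pos (by omega) _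
  θ₅_lt_one := kingTheta_lt_one hL hα
  C₅_nonneg := hC₅
  C₉_nonneg := hC₉
  ω_nonneg := hω0
  ω_lt_one := lt_of_le_of_lt hωρ hρ
  cr_nonneg := hcr
  θ₅_le_ρ := hθρ
  ω_le_ρ := hωρ
  ρ_lt_one := hρ

end KingScales

end YMDAG.N18.KernelStepRateKingMechanism

end
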